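import Summits.BirchSwinnertonDyer.BirchSwinnertonDyer.Theorems.PrintX10bHowardAssembly
import Literature.NumberTheory.EllipticCurves.NonvanishingTwistsProofs
import HarnessLib

/-!
# Line «coprime-frame-supply» (bsd-idea-5 g8, lens TRANSFER) on crux
# `PrintX10b.HowardContainmentAnyClassNumberX10b` (stmt-BirchSwinnertonDyer-23729; row 10, rung W-ALL/10)

BSD is not proved by any of this. PUBLISH-ONLY skeleton (W-79): nothing booked, no route edited.

TRANSFER. The rung `WAllCornerX10b` consumes Howard's containment at ONE Heegner frame per non-CM
rank-one X10b curve (the Hoffstein–Luo frame chosen inside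
`X10b.bsdp_rankOne_of_upperLink_of_mazurMainConjectureOnClassX10b`). On the frames with `3 ∤ h_K` the
containment (indeed the whole two-sided link) is PRINT (Mastella–Zerman 2026 Cor. 4.6 at `p = 3`,
`X10.heegnerContainment_of_cor46_of_not_surj`; `CoprimeTiedX10b` closed, p607508) and the tree already
holds the frame-supply leaf kernel `X10.howardAssemblyThree_of_howardFrameSupply` (p4 g3). So the
any-class-number μ-residual (22642 `MuInequalityCoherentPair`, Howard Thm. 2.2.10 at torsion depth
δ > 0) is replaced by the statement C⁺ = `SupplyCoprimeFrameX10b`: every non-CM rank-one X10b curve HAS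
a light Heegner frame with `3 ∤ h_K` and `L(E^{d_K},1) ≠ 0` — a joint indivisibility / non-vanishing
statement over ℚ (Kohnen–Ono type), moved from anticyclotomic Iwasawa theory to arithmetic statistics.

SKELETON (rev 3 — rev 2 answered critic V#110 P1–P4, all prices paid per V#114a; rev 3 PROVES the
Dirichlet nonemptiness, leaving TWO stubs: BV16 Cor 4(a) by name + the beyond-print D2):
* `stub_bhargavaVarmaCor4aLight` — PRINT BY NAME: the upper-bound half of Bhargava–Varma 2016 Cor. 4 (a)
  for imaginary quadratic FIELDS with the finite local specification «light of level M» (mean of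
  `#Cl[3]` ≤ 2 + ε eventually); a typer-sized Literature fact discharges it.
* `lightClassEventuallyNonempty` — PROVED (rev 3; was `stub_…` in rev 2): the light class is
  eventually non-empty — d = −ℓ for a prime ℓ ≡ −1 (mod 8M) from Mathlib's Dirichlet
  (`Nat.forall_exists_prime_gt_and_zmodEq`), Jacobi symbol (d/q) = (−1+8Mk / q) = 1 via `jacobiSym.mod_left`.
* `classNumberDensityThree_of_print : BV → Dirichlet → D1` — SORRY-FREE (Cauchy in `Cl_K` + the
  mean-to-density count: every field contributes ≥ 1, every field with `3 ∣ h` contributes ≥ 3).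
* `stub_twistNonvanishingDensity` — BEYOND PRINT, LOAD-BEARING (D2): inside the light Heegner class of a
  non-CM rank-one X10b curve the twists with `L(E^d,1) ≠ 0` have lower density > 1/2 (weak Goldfeld on
  an even-parity local class; conjecturally density 1). Weakest form consumed: exactly this `∃ δ > 0`
  lower-density statement, per curve, in `lightClass (3·N_E)`; restricting to CARRIER curves
  (`3 ∣ ∏ c_q`, all that cha-sandwich §1 leaves) shrinks the instrument, not the difficulty.
* `supplyCoprimeFrameX10b_of_hyps : D1 → D2 → C⁺` — pigeonhole + the tree's field/discriminant dictionary
  `exists_heegnerField_iff_exists_fundamental`.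
* `bsdpOnClassX10b_of_supply`, `wallCornerX10b_of_supply`, `wallCornerX10b_of_stubs` — the rung BY NAME
  from C⁺ RELATIVE TO five non-stub inputs, exactly as the landed kernel
  `X10.howardAssemblyThree_of_howardFrameSupply` is: `MastellaZermanHowardDivisibility` (item 25233,
  open, print MZ26 Cor. 4.6), the cite-only composite
  `YanZhu2026.thm57_thm59_bcs422_cgls513_generator_constantCoeff_of_heegnerDivisibility` (body of PrintX9
  aside 24876 — NO PrintX10b binder yet; director's call), `AnalyticMuZeroX10b` (20682, CLOSED),
  `HeegnerPrintFactsX10b` (21206, print bundle), `PrintFactsX10b` (20684, print bundle). The chain decides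
  `WAllCornerX10b` only relative to them; it BYPASSES 23729/23730/22642, it does not conclude them.
-/

set_option autoImplicit false
set_option linter.dupNamespace false

noncomputable section

open scoped Classical

open WeierstrassCurve NumberField
  Literature.NumberTheory.EllipticCurves
  Summit.BirchSwinnertonDyer.BirchSwinnertonDyer.Theses.PrintX10b

open Literature.NumberTheory.EllipticCurves.Rank1Residual (Surj ClassX10)

namespace Summit.BirchSwinnertonDyer.BirchSwinnertonDyer.Cruxes.HowardContainmentAnyClassNumberX10b.CoprimeFrameSupplyX10b

/-! ## The transferred crux C⁺ -/

/-- **C⁺ — coprime light Heegner frame supply on X10b** (the frame-supply hypothesis `hFS3` of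
`X10.howardAssemblyThree_of_howardFrameSupply`, verbatim): every non-CM X10b pair `(E, 3)` with
`ρ̄_{E,3}` not onto and analytic rank one admits an imaginary quadratic `K` with odd `d_K < -4`,
Heegner for `N_E` and for `3`, `3 ∤ h_K`, and `L(E^{(d_K)}, 1) ≠ 0`. Class-wide BEYOND PRINT (joint
indivisibility + non-vanishing); per pair a finite certificate. -/
def SupplyCoprimeFrameX10b : Prop :=
  ∀ (W : WeierstrassCurve ℚ) [W.IsElliptic] [W.IsGloballyMinimal] [NeZero (W.conductorNorm ℤ)]
    (p : ℕ) [Fact p.Prime], ClassX10 W p → ¬ Surj W 3 → ¬ W.HasCM → W.analyticRank = 1 →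
    ∃ (K : Type) (_ : Field K) (_ : NumberField K), IsImaginaryQuadratic K ∧
      Odd (NumberField.discr K) ∧ NumberField.discr K < -4 ∧
      SatisfiesHeegnerHypothesis (W.conductorNorm ℤ) K ∧ SatisfiesHeegnerHypothesis p K ∧
      ¬ p ∣ NumberField.classNumber K ∧
      (W.quadraticTwist (NumberField.discr K : ℚ)).entireLFunction 1 ≠ 0

/-! ## The light Heegner class of level `M` and its counting functions -/

/-- `d` is an odd negative fundamental discriminant `< -4` in which every prime `q ∣ M` splits
(`d ≡ 1 (mod 8)` if `2 ∣ M`, `(d/q) = 1` for odd `q ∣ M`) — the RHS shape of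
`exists_heegnerField_iff_exists_fundamental` with bound `4`, odd branch. -/
def InLightClass (M : ℕ) (d : ℤ) : Prop :=
  d < 0 ∧ d % 4 = 1 ∧ Squarefree d ∧ 4 < d.natAbs ∧
    ∀ q : ℕ, q.Prime → q ∣ M → (q = 2 → d % 8 = 1) ∧ (q ≠ 2 → jacobiSym d q = 1)

/-- `p ∤ h(ℚ(√d))`, stated over every model of the field. -/
def ClassNumberCoprime (p : ℕ) (d : ℤ) : Prop :=
  ∀ (K : Type) [Field K] [NumberField K], IsImaginaryQuadratic K → NumberField.discr K = d →
    ¬ p ∣ NumberField.classNumber K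

/-- the members of the light class of level `M` with `|d| ≤ X` -/
def lightClass (M X : ℕ) : Finset ℤ :=
  (Finset.Icc (-(X : ℤ)) (-1)).filter (InLightClass M)

/-- … those with `p ∤ h(d)` -/
def coprimeClass (p M X : ℕ) : Finset ℤ :=
  (Finset.Icc (-(X : ℤ)) (-1)).filter (fun d ↦ InLightClass M d ∧ ClassNumberCoprime p d)

/-- … those with `L(W^{(d)}, 1) ≠ 0` -/
def nonvanishingClass (W : WeierstrassCurve ℚ) (M X : ℕ) : Finset ℤ :=
  (Finset.Icc (-(X : ℤ)) (-1)).filter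
    (fun d ↦ InLightClass M d ∧ (W.quadraticTwist (d : ℚ)).entireLFunction 1 ≠ 0)

/-! ## The two stub statements -/

/-- **D1 (PRINT-GRADE; Davenport–Heilbronn with local conditions — Bhargava–Varma 2016 Cor. 4 (a):
the mean number of 3-torsion elements of the class groups of the imaginary quadratic fields in a family
cut out by finitely many local conditions is 2, hence the lower density of `3 ∤ h` in the family is
≥ 1/2; Dirichlet: the light class of level `M` is eventually non-empty).** For every level `M > 0` and
`ε > 0`, eventually in `X`: the light class is non-empty and at least `(1/2 − ε)` of it has `3 ∤ h(d)`.
[cite: arXiv:1401.5875, Cor. 4 (a)] -/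
def Stmt.classNumberDensityThree : Prop :=
  ∀ M : ℕ, 0 < M → ∀ ε : ℝ, 0 < ε → ∃ X₀ : ℕ, ∀ X : ℕ, X₀ ≤ X →
    0 < (lightClass M X).card ∧
      ((1 : ℝ) / 2 - ε) * (lightClass M X).card ≤ (coprimeClass 3 M X).card

/-- **D2 (BEYOND PRINT, LOAD-BEARING; weak Goldfeld on an even-parity local class).** For a
non-CM X10b pair `(E,3)` with `ρ̄_{E,3}` not onto and analytic rank one (root number `−1`, so every
member `d` of the light Heegner class of level `3 N_E` gives `E^{(d)}` root number `+1`), the twists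
with `L(E^{(d)},1) ≠ 0` have lower density `> 1/2` in that class. Known: density `0` results only
(Ono–Skinner; Kriz–Li `≫ X / log^{5/8} X`); positive density for curves with a rational 3-isogeny
(Kriz–Li 2019), which X10b curves are not. [cite: doi:10.1017/fms.2019.9, Thm. 1.1–1.5] -/
def Stmt.twistNonvanishingDensityX10b : Prop :=
  ∀ (W : WeierstrassCurve ℚ) [W.IsElliptic] [W.IsGloballyMinimal] [NeZero (W.conductorNorm ℤ)]
    (p : ℕ) [Fact p.Prime], ClassX10 W p → ¬ Surj W 3 → ¬ W.HasCM → W.analyticRank = 1 →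
    ∃ δ : ℝ, 0 < δ ∧ ∃ X₀ : ℕ, ∀ X : ℕ, X₀ ≤ X →
      ((1 : ℝ) / 2 + δ) * (lightClass (W.conductorNorm ℤ * p) X).card ≤
        (nonvanishingClass W (W.conductorNorm ℤ * p) X).card

/-! ## D1 discharged to print shapes (rev 2, critic V#110 P2) -/

/-- `n` is the number of 3-torsion ideal classes of (a model of) the imaginary quadratic field of
discriminant `d`. -/
def IsThreeTorsionCount (d : ℤ) (n : ℕ) : Prop :=
  ∃ (K : Type) (_ : Field K) (_ : NumberField K), IsImaginaryQuadratic K ∧ NumberField.discr K = d ∧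
    n = Nat.card {c : ClassGroup (𝓞 K) // c ^ 3 = 1}

/-- **BV (PRINT, by-name shape of Bhargava–Varma 2016, Cor. 4 (a), upper-bound half) for imaginary
quadratic FIELDS with the finite local specification «light of level `M`» (`d ≡ 1 (mod 8)` if `2 ∣ M`,
`(d/q) = 1` for odd primes `q ∣ M`, `d` odd fundamental `< -4`): the average number of 3-torsion ideal
classes over the light class is eventually `≤ 2 + ε`.** («Suppose one restricts to just those quadratic
fields satisfying any specified set of local conditions at any finite set of primes. Then … (a) the
average number of 3-torsion elements in the class groups of such imaginary quadratic fields is 2.»)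
[cite: arXiv:1401.5875, Cor. 4 (a)] -/
def Stmt.bhargavaVarmaCor4aLight : Prop :=
  ∀ M : ℕ, 0 < M → ∀ ε : ℝ, 0 < ε → ∃ X₀ : ℕ, ∀ X : ℕ, X₀ ≤ X →
    ∀ t : ℤ → ℕ, (∀ d ∈ lightClass M X, IsThreeTorsionCount d (t d)) →
      (∑ d ∈ lightClass M X, (t d : ℝ)) ≤ (2 + ε) * (lightClass M X).card

/-- **Dirichlet (PRINT): the light class of a positive level is eventually non-empty** (a prime
`ℓ ≡ 3 (mod 4)`, `ℓ > 4`, in the residue class modulo `8M` making every `q ∣ M` split in `ℚ(√-ℓ)`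
gives `d = -ℓ`; Mathlib: `Nat.forall_exists_prime_gt_and_eq_mod` + quadratic reciprocity).
[cite: IrelandRosen1990, Ch. 16 §1; Prop. 5.2.2] -/
def Stmt.lightClassEventuallyNonempty : Prop :=
  ∀ M : ℕ, 0 < M → ∃ X₀ : ℕ, ∀ X : ℕ, X₀ ≤ X → 0 < (lightClass M X).card

/-! ## Registered stubs -/

/-- stub BV — PRINT by name (Bhargava–Varma 2016 Cor. 4 (a)); a typer-sized Literature fact
`BhargavaVarma2016.cor4a_imaginary_localSpec` discharges it. [cite: arXiv:1401.5875, Cor. 4 (a)] -/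
theorem stub_bhargavaVarmaCor4aLight : Stmt.bhargavaVarmaCor4aLight := by
  sorry

/-- **Dirichlet, PROVED (rev 3)**: the light class of a positive level is eventually non-empty —
`d = -ℓ` for a prime `ℓ ≡ -1 (mod 8M)`, `ℓ > 4` (Mathlib's Dirichlet theorem
`Nat.forall_exists_prime_gt_and_zmodEq`); then `d ≡ 1 (mod 8)` and `d ≡ 1 (mod q)` for every `q ∣ M`,
so `(d/q) = (1/q) = 1` (`jacobiSym.mod_left`, `jacobiSym.one_left`). -/
theorem lightClassEventuallyNonempty : Stmt.lightClassEventuallyNonempty := by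
  intro M hM
  have hq : (8 * M : ℕ) ≠ 0 := by positivity
  have hcop : IsCoprime (-1 : ℤ) ((8 * M : ℕ) : ℤ) := isCoprime_one_left.neg_left
  obtain ⟨ℓ, hℓ4, hℓp, hℓmod⟩ := Nat.forall_exists_prime_gt_and_zmodEq 4 hq hcop
  -- `8M ∣ ℓ + 1`
  have hdvd : ((8 * M : ℕ) : ℤ) ∣ (ℓ : ℤ) + 1 := by
    have := hℓmod.symm.dvd  -- 8M ∣ ℓ - (-1)
    simpa [sub_neg_eq_add] using this
  refine ⟨ℓ, fun X hX ↦ ?_⟩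
  apply Finset.card_pos.mpr
  refine ⟨-(ℓ : ℤ), ?_⟩
  simp only [lightClass, Finset.mem_filter, Finset.mem_Icc]
  refine ⟨⟨by omega, by omega⟩, ?_⟩
  -- membership in the light class
  obtain ⟨t, ht⟩ := hdvd
  have h8 : ∃ s : ℤ, (ℓ : ℤ) + 1 = 8 * s := ⟨(M : ℤ) * t, by rw [ht]; push_cast; ring⟩
  obtain ⟨s, hs⟩ := h8
  unfold InLightClass
  refine ⟨by omega, by omega, ?_, ?_, ?_⟩
  · -- squarefree
    rw [← Int.squarefree_natAbs, Int.natAbs_neg, Int.natAbs_natCast]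
    exact hℓp.prime.squarefree
  · -- `4 < |d|`
    rw [Int.natAbs_neg, Int.natAbs_natCast]; exact hℓ4
  · intro q hqprime hqM
    refine ⟨fun _ ↦ by omega, fun hq2 ↦ ?_⟩
    -- `d ≡ 1 (mod q)` since `q ∣ 8M ∣ ℓ + 1`
    have hqd : (q : ℤ) ∣ (ℓ : ℤ) + 1 := by
      refine dvd_trans ?_ ⟨t, ht⟩
      exact_mod_cast (dvd_mul_of_dvd_right hqM 8)
    obtain ⟨u, hu⟩ := hqd
    have hq1 : (1 : ℤ) < q := by exact_mod_cast hqprime.one_lt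
    have hmod : (-(ℓ : ℤ)) % (q : ℤ) = 1 := by
      rw [show (-(ℓ : ℤ)) = 1 + (q : ℤ) * (-u) by linear_combination -hu, Int.add_mul_emod_self_left]
      exact Int.emod_eq_of_lt (by norm_num) hq1
    rw [jacobiSym.mod_left, hmod]
    exact jacobiSym.one_left q

/-- stub D2 — BEYOND PRINT, the load-bearing statement of the line. [cite: doi:10.1017/fms.2019.9, Thm. 1.1] -/
theorem stub_twistNonvanishingDensity : Stmt.twistNonvanishingDensityX10b := by
  sorry

/-! ## D1 from BV + Dirichlet (sorry-free: Cauchy + the mean-to-density count) -/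

theorem one_le_card_threeTorsion (K : Type) [Field K] [NumberField K] :
    1 ≤ Nat.card {c : ClassGroup (𝓞 K) // c ^ 3 = 1} := by
  haveI : Nonempty {c : ClassGroup (𝓞 K) // c ^ 3 = 1} := ⟨⟨1, one_pow 3⟩⟩
  exact Nat.card_pos

/-- Cauchy: `3 ∣ h_K` gives an ideal class of order 3, hence at least three 3-torsion classes. -/
theorem three_le_card_threeTorsion {K : Type} [Field K] [NumberField K]
    (h : 3 ∣ NumberField.classNumber K) : 3 ≤ Nat.card {c : ClassGroup (𝓞 K) // c ^ 3 = 1} := by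
  haveI : Fact (Nat.Prime 3) := ⟨Nat.prime_three⟩
  obtain ⟨x, hx⟩ := exists_prime_orderOf_dvd_card 3 h
  have h3 : x ^ 3 = 1 := by rw [← hx]; exact pow_orderOf_eq_one x
  have hmem : ∀ c : Subgroup.zpowers x, (c : ClassGroup (𝓞 K)) ^ 3 = 1 := by
    intro c
    obtain ⟨k, hk⟩ := Subgroup.mem_zpowers_iff.mp c.2
    rw [← hk, ← zpow_natCast, ← zpow_mul, mul_comm, zpow_mul, zpow_natCast, h3, one_zpow]
  let f : Subgroup.zpowers x → {c : ClassGroup (𝓞 K) // c ^ 3 = 1} := fun c ↦ ⟨c, hmem c⟩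
  have hf : Function.Injective f := by
    intro a b hab
    exact Subtype.ext (congrArg (fun z : {c : ClassGroup (𝓞 K) // c ^ 3 = 1} ↦ z.1) hab)
  calc 3 = orderOf x := hx.symm
    _ = Nat.card (Subgroup.zpowers x) := (Nat.card_zpowers x).symm
    _ ≤ Nat.card {c : ClassGroup (𝓞 K) // c ^ 3 = 1} := Nat.card_le_card_of_injective f hf

/-- **BV ∧ Dirichlet ⟹ D1**: if the mean of `#Cl[3]` over the light class is `≤ 2 + ε`, then, since every
field contributes `≥ 1` and every field with `3 ∣ h` contributes `≥ 3`, at least `(1/2 − ε)` of the light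
class has `3 ∤ h`. -/
theorem classNumberDensityThree_of_print (hBV : Stmt.bhargavaVarmaCor4aLight)
    (hne : Stmt.lightClassEventuallyNonempty) : Stmt.classNumberDensityThree := by
  intro M hM ε hε
  obtain ⟨X₁, hX₁⟩ := hBV M hM ε hε
  obtain ⟨X₂, hX₂⟩ := hne M hM
  refine ⟨max X₁ X₂, fun X hX ↦ ⟨hX₂ X (le_of_max_le_right hX), ?_⟩⟩
  have hmodel : ∀ d ∈ lightClass M X, ∃ n : ℕ, IsThreeTorsionCount d n ∧ 1 ≤ n ∧
      (¬ ClassNumberCoprime 3 d → 3 ≤ n) := by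
    intro d hd
    by_cases hc : ClassNumberCoprime 3 d
    · have hdl : InLightClass M d := (Finset.mem_filter.mp hd).2
      have hfd : (d % 4 = 1 ∧ Squarefree d ∧ d ≠ 1) ∨
          (4 ∣ d ∧ (d / 4 % 4 = 2 ∨ d / 4 % 4 = 3) ∧ Squarefree (d / 4)) :=
        Or.inl ⟨hdl.2.1, hdl.2.2.1, by have := hdl.1; omega⟩
      obtain ⟨K, _, _, h2, hdK⟩ := Literature.NumberTheory.QuadraticFields.Quadratic.exists_numberField_discr_eq hfd
      have hK : IsImaginaryQuadratic K := isImaginaryQuadratic_iff_discr_neg.mpr ⟨h2, hdK ▸ hdl.1⟩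
      exact ⟨_, ⟨K, inferInstance, inferInstance, hK, hdK, rfl⟩, one_le_card_threeTorsion K,
        fun h ↦ (h hc).elim⟩
    · have hc' := hc
      unfold ClassNumberCoprime at hc'
      push Not at hc'
      obtain ⟨K, _, _, hK, hdK, h3⟩ := hc'
      exact ⟨_, ⟨K, inferInstance, inferInstance, hK, hdK, rfl⟩, one_le_card_threeTorsion K,
        fun _ ↦ three_le_card_threeTorsion h3⟩
  choose! t ht using hmodel
  have hsum := hX₁ X (le_of_max_le_left hX) t (fun d hd ↦ (ht d hd).1)
  -- split the light class by `3 ∤ h`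
  set L := lightClass M X with hL
  have hC : L.filter (fun d ↦ ClassNumberCoprime 3 d) = coprimeClass 3 M X := by
    simp only [hL, lightClass, coprimeClass, Finset.filter_filter]
  have hsplit := Finset.sum_filter_add_sum_filter_not L (fun d ↦ ClassNumberCoprime 3 d) t
  have hcards := Finset.card_filter_add_card_filter_not (s := L) (fun d ↦ ClassNumberCoprime 3 d)
  have hlow1 : (L.filter (fun d ↦ ClassNumberCoprime 3 d)).card ≤
      ∑ d ∈ L.filter (fun d ↦ ClassNumberCoprime 3 d), t d := by
    rw [Finset.card_eq_sum_ones]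
    exact Finset.sum_le_sum (fun d hd ↦ (ht d (Finset.mem_filter.mp hd).1).2.1)
  have hlow2 : 3 * (L.filter (fun d ↦ ¬ ClassNumberCoprime 3 d)).card ≤
      ∑ d ∈ L.filter (fun d ↦ ¬ ClassNumberCoprime 3 d), t d := by
    rw [mul_comm, Finset.card_eq_sum_ones, Finset.sum_mul]
    exact Finset.sum_le_sum (fun d hd ↦ by
      have h := Finset.mem_filter.mp hd
      simpa using (ht d h.1).2.2 h.2)
  -- to ℝ
  set a := (L.filter (fun d ↦ ClassNumberCoprime 3 d)).card with ha
  set b := (L.filter (fun d ↦ ¬ ClassNumberCoprime 3 d)).card with hb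
  have hS : a + 3 * b ≤ ∑ d ∈ L, t d := by rw [← hsplit]; exact Nat.add_le_add hlow1 hlow2
  have hLab : L.card = a + b := hcards.symm
  have hSR : ((a : ℝ) + 3 * b) ≤ (2 + ε) * ((a : ℝ) + b) := by
    have h1 : ((a + 3 * b : ℕ) : ℝ) ≤ ((∑ d ∈ L, t d : ℕ) : ℝ) := by exact_mod_cast hS
    have h2 : ((∑ d ∈ L, t d : ℕ) : ℝ) = ∑ d ∈ L, (t d : ℝ) := by push_cast; rfl
    rw [h2] at h1
    have h3 : ((L.card : ℕ) : ℝ) = (a : ℝ) + b := by rw [hLab]; push_cast; rfl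
    rw [h3] at hsum
    have h4 : ((a + 3 * b : ℕ) : ℝ) = (a : ℝ) + 3 * b := by push_cast; rfl
    linarith [h1, hsum, h4.symm.le, h4.le]
  rw [← hC, hLab]
  push_cast
  nlinarith [hSR, mul_nonneg hε.le (Nat.cast_nonneg a : (0:ℝ) ≤ a),
    mul_nonneg hε.le (Nat.cast_nonneg b : (0:ℝ) ≤ b), (Nat.cast_nonneg a : (0:ℝ) ≤ a),
    (Nat.cast_nonneg b : (0:ℝ) ≤ b)]

/-- D1, now derived (sorries only via the two print stubs). -/
theorem classNumberDensity_of_stubs : Stmt.classNumberDensityThree :=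
  classNumberDensityThree_of_print stub_bhargavaVarmaCor4aLight lightClassEventuallyNonempty

/-! ## Compositions (sorry-free) -/

/-- pigeonhole: two subsets of a finite set whose sizes add up to more than the whole meet -/
theorem exists_mem_inter_of_card {α : Type*} [DecidableEq α] {D A B : Finset α} (hA : A ⊆ D) (hB : B ⊆ D)
    (h : D.card < A.card + B.card) : ∃ d, d ∈ A ∧ d ∈ B := by
  by_contra hne
  have hdisj : Disjoint A B := Finset.disjoint_left.mpr (fun d hdA hdB ↦ hne ⟨d, hdA, hdB⟩)
  have hU : (A ∪ B).card ≤ D.card := Finset.card_le_card (Finset.union_subset hA hB)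
  rw [Finset.card_union_of_disjoint hdisj] at hU
  omega

/-- **D1 ∧ D2 ⟹ C⁺.** -/
theorem supplyCoprimeFrameX10b_of_hyps
    (hD1 : Stmt.classNumberDensityThree) (hD2 : Stmt.twistNonvanishingDensityX10b) :
    SupplyCoprimeFrameX10b := by
  intro W _ _ _ p _ hX hns hcm hr
  obtain ⟨hp3, -, -, -⟩ := id hX
  subst hp3
  set M : ℕ := W.conductorNorm ℤ * 3 with hM
  have hMpos : 0 < M := Nat.mul_pos (Nat.pos_of_ne_zero (NeZero.ne _)) (by norm_num)
  obtain ⟨δ, hδ, X₁, hX₁⟩ := hD2 W 3 hX hns hcm hr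
  obtain ⟨X₂, hX₂⟩ := hD1 M hMpos (δ / 2) (by positivity)
  set X : ℕ := max X₁ X₂ with hXdef
  obtain ⟨hDpos, hAX⟩ := hX₂ X (le_max_right _ _)
  have hBX := hX₁ X (le_max_left _ _)
  -- the two subsets of the light class
  have hAsub : coprimeClass 3 M X ⊆ lightClass M X := by
    intro d hd
    simp only [coprimeClass, lightClass, Finset.mem_filter] at hd ⊢
    exact ⟨hd.1, hd.2.1⟩
  have hBsub : nonvanishingClass W M X ⊆ lightClass M X := by
    intro d hd
    simp only [nonvanishingClass, lightClass, Finset.mem_filter] at hd ⊢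
    exact ⟨hd.1, hd.2.1⟩
  -- sizes add up to more than the whole
  have hlt : (lightClass M X).card < (coprimeClass 3 M X).card + (nonvanishingClass W M X).card := by
    have hDr : (0 : ℝ) < (lightClass M X).card := by exact_mod_cast hDpos
    have hsum : ((lightClass M X).card : ℝ) <
        (coprimeClass 3 M X).card + (nonvanishingClass W M X).card := by
      have : ((lightClass M X).card : ℝ) < ((1 : ℝ) / 2 - δ / 2) * (lightClass M X).card +
          ((1 : ℝ) / 2 + δ) * (lightClass M X).card := by nlinarith
      linarith
    exact_mod_cast hsum
  obtain ⟨d, hdA, hdB⟩ := exists_mem_inter_of_card hAsub hBsub hlt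
  simp only [coprimeClass, nonvanishingClass, Finset.mem_filter] at hdA hdB
  obtain ⟨-, ⟨hdneg, hd4, hsq, hBd, hspl⟩, hh⟩ := hdA
  obtain ⟨-, -, hLd⟩ := hdB
  -- from the discriminant to the field
  obtain ⟨K, _, _, hK, hBK, hH, hPK⟩ :=
    (exists_heegnerField_iff_exists_fundamental M 4
      (fun D ↦ D % 4 = 1 ∧ ClassNumberCoprime 3 D ∧
        (W.quadraticTwist (D : ℚ)).entireLFunction 1 ≠ 0)).mpr
      ⟨d, hdneg, Or.inl ⟨hd4, hsq, by omega⟩, hBd, hspl, hd4, hh, hLd⟩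
  obtain ⟨hK4, hhK, hLK⟩ := hPK
  have hneg : NumberField.discr K < 0 := IsImaginaryQuadratic.discr_neg hK
  refine ⟨K, inferInstance, inferInstance, hK, Int.odd_iff.mpr (by omega), by omega,
    hH.of_dvd (dvd_mul_right _ _), hH.of_dvd (dvd_mul_left _ _), hhK K hK rfl, hLK⟩

/-- **C⁺ ⟹ the X10b leaf, on route items + one cite-only composite** (the tree kernel
`X10.howardAssemblyThree_of_howardFrameSupply`, p4 g3). -/
theorem bsdpOnClassX10b_of_supply (hS : SupplyCoprimeFrameX10b)
    (hMZ : MastellaZermanHowardDivisibility)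
    (hYZ : YanZhu2026.thm57_thm59_bcs422_cgls513_generator_constantCoeff_of_heegnerDivisibility)
    (hA : AnalyticMuZeroX10b) (hHP : HeegnerPrintFactsX10b) (hP : PrintFactsX10b) :
    Summit.BirchSwinnertonDyer.Rank1Residual.X10.BSDpOnClassX10b :=
  Summit.BirchSwinnertonDyer.Rank1Residual.X10.howardAssemblyThree_of_howardFrameSupply hS hMZ hYZ hA hHP hP

/-- **C⁺ ⟹ the rung `WAllCornerX10b` BY NAME** — the alternative deciding theorem this line offers
the director (items 25233, 20682, 21206, 20684 + the new crux + PrintX9's aside 24876 as a binder). -/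
theorem wallCornerX10b_of_supply (hS : SupplyCoprimeFrameX10b)
    (hMZ : MastellaZermanHowardDivisibility)
    (hYZ : YanZhu2026.thm57_thm59_bcs422_cgls513_generator_constantCoeff_of_heegnerDivisibility)
    (hA : AnalyticMuZeroX10b) (hHP : HeegnerPrintFactsX10b) (hP : PrintFactsX10b) :
    Summit.BirchSwinnertonDyer.WAllCornerX10b :=
  Summit.BirchSwinnertonDyer.Rank1Residual.WAll.wallCornerX10b_of_bsdpOnClassX10b
    (bsdpOnClassX10b_of_supply hS hMZ hYZ hA hHP hP)

/-- **The registered composition: stubs ⟹ rung** (sorries only inside `stub_*`). -/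
theorem wallCornerX10b_of_stubs
    (hMZ : MastellaZermanHowardDivisibility)
    (hYZ : YanZhu2026.thm57_thm59_bcs422_cgls513_generator_constantCoeff_of_heegnerDivisibility)
    (hA : AnalyticMuZeroX10b) (hHP : HeegnerPrintFactsX10b) (hP : PrintFactsX10b) :
    Summit.BirchSwinnertonDyer.WAllCornerX10b :=
  wallCornerX10b_of_supply
    (supplyCoprimeFrameX10b_of_hyps classNumberDensity_of_stubs stub_twistNonvanishingDensity)
    hMZ hYZ hA hHP hP

end Summit.BirchSwinnertonDyer.BirchSwinnertonDyer.Cruxes.HowardContainmentAnyClassNumberX10b.CoprimeFrameSupplyX10b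

end
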